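import Mathlib

/-!
# `Balaban1983to89.B14StarSet` — [Balaban1988Convergent] (1.9) p. 247: the starred bond set
`X* = X ∖ {b₀(c) : c ∈ X^{(1)}}`, and the bond count of p. 249

statement-level skeleton of published theorems with citation tags; proofs where landed; nothing here is a
claim about the Yang–Mills mass gap

CITATION HEADER (lean-in-tree rule).  Source: T. Bałaban, *Convergent renormalization expansions for lattice gauge
theories*, Commun. Math. Phys. **119**, 243–285 (1988), doi:10.1007/bf01217741 [Balaban1988Convergent] (cell paper
B14; held `paper:balaban1988-cmp119-convergent-renormalization`, journal page = PDF page + 242; displays read on the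
x2 renders p005 (p. 247) and p007 (p. 249)); the bond `b₀(c)` is [Balaban1985UV3] p. 260, the text after (17) (PDF p. 6; cell paper B10 =
B14's ref. [16]).  Mega-formalization `lit-balaban`, unit `lit-balaban-r11` (CMP 119), SKELETON rows B14-1.9, B14-p249.

THE PRINTED TEXT (verbatim).
* p. 247 [PDF 5]: *"The superscript * used in (1.8) means that we take the set of all bonds with at least one
  end-point belonging to □′^{∼2}, except the bonds b₀(c) for c, such that at least one end-point belongs to
  (□′^{∼2})^{(1)}. More generally, for a set X, which is a union of unit blocks, we define
  X* = X ∖ {b₀(c) : c ∈ X^{(1)}}. (1.9)"*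
* p. 249 [PDF 7]: *"Let us recall that the linearizing transformation is different from the identity only on bonds
  {b₀(c) : c ∈ Ω₁^{(1)}}, hence the characteristic function χ₀′(Ω₁), defined in (1.8), is unchanged under the
  transformation. The number |Ω₁*| is the number of bonds belonging to Ω₁ minus the number of bonds in the set
  {b₀(c) : c ∈ Ω₁^{(1)}}. … we denote by A the integration variables restricted to bonds Ω₁* = Ω₁∖{b₀(c) : c ∈ Ω₁^{(1)}}."*
* [Balaban1985UV3] p. 260 (text after (17); erratum: an earlier header said p. 262): *"Let us denote by b₀(c) the bond b ∈ B(c) and contained in c"*.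

WHAT IS TYPED.  ABSTRACTLY, over a type `B` of fine bonds and a type `C` of coarse bonds with the assignment
`b₀ : C → B` of B10 (17) as DATA (the block geometry `B(c)`, the contour `c` and the choice of `b₀(c)` inside it are
not modelled — the sibling module `T4AdjointCovarianceWords` takes the same abstraction, `Ω₁*` = a set of "free"
indices): `star XB X1 b₀ = XB ∖ b₀(X1)` for the fine-bond set `XB` of `X` and the coarse-bond set `X1` of `X^{(1)}`
((1.9)), and the p. 249 count `|X*| = |X| − |{b₀(c) : c ∈ X^{(1)}}|`, KERNEL-CHECKED from the two facts it silently
uses: every `b₀(c)`, `c ∈ X^{(1)}`, is a bond of `X`, and `c ↦ b₀(c)` is injective (distinct coarse bonds have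
distinct representative fine bonds).  Nothing printed is asserted beyond this; no `sorry`, no axiom.
-/

namespace Literature.MathematicalPhysics.QuantumFieldTheory.Balaban1983to89.B14.StarSet

variable {B C : Type*} [DecidableEq B]

/-- **(1.9) p. 247**: `X* = X ∖ {b₀(c) : c ∈ X^{(1)}}` — the bonds `XB` of a union of unit blocks `X` with the
representative bonds `b₀(c)` of the coarse bonds `c ∈ X1 = X^{(1)}` removed (`b₀ : C → B` the assignment of
[Balaban1985UV3] (17)). [cite: Balaban1988Convergent, (1.9) p.247] -/
def star (XB : Finset B) (X1 : Finset C) (b₀ : C → B) : Finset B := XB \ X1.image b₀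

/-- Membership in `X*`: a bond of `X` which is no `b₀(c)`, `c ∈ X^{(1)}`. [cite: Balaban1988Convergent, (1.9) p.247] -/
theorem mem_star {XB : Finset B} {X1 : Finset C} {b₀ : C → B} {b : B} :
    b ∈ star XB X1 b₀ ↔ b ∈ XB ∧ ∀ c ∈ X1, b₀ c ≠ b := by
  simp [star, Finset.mem_sdiff, Finset.mem_image]

/-- `X* ⊆ X`. [cite: Balaban1988Convergent, (1.9) p.247] -/
theorem star_subset (XB : Finset B) (X1 : Finset C) (b₀ : C → B) : star XB X1 b₀ ⊆ XB :=
  Finset.sdiff_subset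

/-- The removed bonds are exactly the `b₀(c)`: `b₀(c) ∉ X*` for `c ∈ X^{(1)}` (p. 249: the linearizing
transformation acts only on these bonds, so functions of the `X*`-variables are unchanged). [cite: Balaban1988Convergent, p.249] -/
theorem b0_not_mem_star (XB : Finset B) (X1 : Finset C) (b₀ : C → B) {c : C} (hc : c ∈ X1) :
    b₀ c ∉ star XB X1 b₀ := by
  rw [mem_star]
  push Not
  intro _
  exact ⟨c, hc, rfl⟩

/-- **p. 249, verbatim: *"The number |Ω₁*| is the number of bonds belonging to Ω₁ minus the number of bonds in the
set {b₀(c) : c ∈ Ω₁^{(1)}}."***  Holds as soon as every `b₀(c)`, `c ∈ X^{(1)}`, is a bond of `X`. [cite: Balaban1988Convergent, p.249, (1.9) p.247] -/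
theorem card_star (XB : Finset B) (X1 : Finset C) (b₀ : C → B) (hsub : X1.image b₀ ⊆ XB) :
    (star XB X1 b₀).card = XB.card - (X1.image b₀).card := by
  unfold star
  exact Finset.card_sdiff_of_subset hsub

/-- The same count with the number of COARSE bonds: `|X*| = |X| − |X^{(1)}|`, when in addition distinct coarse bonds
have distinct representatives (`b₀` injective on `X^{(1)}` — immediate from "b₀(c) contained in c",
[Balaban1985UV3] (17)). [cite: Balaban1988Convergent, p.249, (1.9) p.247] -/
theorem card_star_of_injOn (XB : Finset B) (X1 : Finset C) (b₀ : C → B) (hsub : X1.image b₀ ⊆ XB)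
    (hinj : Set.InjOn b₀ X1) : (star XB X1 b₀).card = XB.card - X1.card := by
  rw [card_star XB X1 b₀ hsub, Finset.card_image_of_injOn hinj]

/-- `|X*| + |{b₀(c)}| = |X|`: the bond variables of `X` split into the integration variables on `X*` and the
dependent variables `A′(b₀(c))` solved from `(Q̃A′)(c) = 0` (p. 249). [cite: Balaban1988Convergent, p.249] -/
theorem card_star_add (XB : Finset B) (X1 : Finset C) (b₀ : C → B) (hsub : X1.image b₀ ⊆ XB) :
    (star XB X1 b₀).card + (X1.image b₀).card = XB.card := by
  unfold star
  exact Finset.card_sdiff_add_card_eq_card hsub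

end Literature.MathematicalPhysics.QuantumFieldTheory.Balaban1983to89.B14.StarSet
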